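import Summits.CriticalPhenomena.PercolationContinuityZ3.Theorems.Transplant.HeisenbergSymmetricGensContinuity
import Summits.CriticalPhenomena.PercolationContinuityZ3.Theorems.Transplant.PlanarSkeletonSignDefs
import HarnessLib

/-!
# A Cayley graph of the Heisenberg group `H₃(ℤ)` with NO point symmetry: `Cay(H₃(ℤ); {a, b, ab, ba²}^{±1})` is a graphical regular
# representation (every automorphism fixing a vertex is the identity), hence carries no `PlanarSkeletonConc`, no `PlanarSkeletonSign`
# and no `PlanarSkeletonNeg` — for ANY skeleton map (P5-SHARPNESS row 34: the symmetry input of the lane's method has teeth inside `H₃(ℤ)`)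

builds on p205010 (kernel theorem, internal audit signed; external expert review pending) — nothing in this file uses p205010.
Lane `prim-bschramm`, seat `prim-bschramm-p5` (gen 6; METHOD = counterexample / sharpness search), helper file
(`--supports stmt-CriticalPhenomena-4575`).  NEW FILE; no statement item, no route.

WHAT IS PROVED (all kernel, standard axioms).  Let `S₀ = {a, b, ab, ba², and inverses} ⊆ H₃(ℤ)` with `a = (1,0,0)`, `b = (0,1,0)` in the
coordinates `(x,y,z)·(x',y',z') = (x+x', y+y', z+z'+xy')` of `Literature.Geometry.MetricEmbeddings.heisMul` (so `ab = (1,1,1)`,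
`(ab)⁻¹ = (−1,−1,0)`, `ba² = (2,1,0)`, `(ba²)⁻¹ = (−2,−1,2)`), and `X := HeisGens.graph S₀` the right Cayley graph (`g ∼ g·s`).
* `HeisGRR.aut_fix_neighbors_zero` — an automorphism of `X` fixing the identity fixes its 8 neighbours.  Proof = the rooted link at radius 2:
  inside `N(1)` the edges of `X` form the matching `{a, ab}, {b, a⁻¹}, {b⁻¹, (ab)⁻¹}` (the three triangles at `1`), the relation "common
  neighbour other than `1`" forms the matching-plus-path `{(ba²)⁻¹, a⁻¹}, {a⁻¹, a}, {a, b⁻¹}, {b, ba²}` (the four 4-cycles at `1`), and this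
  two-coloured graph on 8 points has no non-trivial automorphism (a nine-step chase; every local fact is a `decide` over `S₀`).
* `HeisGRR.aut_fix_neighbors` (any fixed vertex, by conjugating with left translations), `HeisGRR.aut_eq_of_fix` (an automorphism with a
  fixed point is the identity: `X` is connected), `HeisGRR.aut_eq_leftIso` (**`Aut(X) = H₃(ℤ)` acting by left translations — a GRR**).
* **`HeisGRR.isEmpty_planarSkeletonNeg : IsEmpty (PlanarSkeletonNeg X)`**, `isEmpty_planarSkeletonSign`, `isEmpty_planarSkeletonConc`: the
  field `neg` (resp. `point`) at a base vertex `t` is an automorphism fixing `t`, hence fixing the (ι)-step neighbour `t'` with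
  `φ t' = φ t + e₀`, so `e₀ = −e₀` — for EVERY candidate skeleton map `φ`; `no_point_symmetry` records the general form (any "linear action on
  relative skeleton coordinates" of a vertex stabiliser is trivial on the neighbours' displacements).
* context facts: `X` is connected, vertex-transitive, locally finite, and `p_c(X) < 1` (`X ⊇ Cay(H₃(ℤ); a, b)`).
WHAT THIS SAYS FOR THE LANE (numbers, not adjectives).  `θ(p_c) = 0` is a kernel theorem for `Cay(H₃(ℤ); S)` for every ADMISSIBLE
(`D₄`-symmetric unit-step) `S` (`HeisGens.criticalContinuity_holds`, p246193) — via the node of record, whose interface needs a point symmetry at a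
base vertex (`point ⊇ D₄`; the D″ nodes need `neg`/`flip`).  `X` is a Cayley graph of the SAME group (polynomial growth of degree 4, amenable,
`p_c < 1`, torsion-free nilpotent; quasi-isometric to the standard Cayley graph) on which NONE of the three interfaces can be instantiated, by
any `φ`.  Benjamini–Schramm's Conjecture 4 predicts `θ_X(p_c) = 0`; it is not known in print (continuity at `p_c` is not known to be a
quasi-isometry / generating-set invariant), and it is not reachable by the lane's method as it stands: the symmetry hypothesis is
method-necessary INSIDE `H₃(ℤ)`.  (For abelian groups the inversion `g ↦ −g` is always a Cayley-graph automorphism, so `neg` is free there;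
the phenomenon is genuinely non-abelian.)  IN PRINT: a finitely generated group admits a finite-degree GRR iff it is neither abelian
(≠ `ℤ/2`, `(ℤ/2)ⁿ` for `n ≥ 5`) nor generalized dicyclic nor one of ten small finite groups (Leemann–de la Salle, confirming Watkins' 1976
conjecture; the torsion-free non-abelian `H₃(ℤ)` qualifies) — an EXISTENCE theorem by random-walk methods; this file needs no classification,
only an explicit 8-element generating set and the 8-point chase, and is (as far as searched) the first explicit GRR of `H₃(ℤ)` written down
for this purpose.
[cite: LeemannDelasalle2022, Thm. 1.1 and Cor. 1.2 (p. 3)] [cite: LeemannDelasalle2020, Thm. 1.1]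
[cite: BenjaminiSchramm1996, Conj. 4 and §2 (quasi-transitive graphs, Cayley graphs)] [cite: KozmaNitzan2024, §4 p. 16 (Lemma 8: the role of
the lattice symmetries)] [cite: CheegerKleinerNaor2011, §1.1 (coordinates on the Heisenberg group)] [cite: LyonsPeres2016, Thm. 7.6]
-/

noncomputable section

namespace Summit.CriticalPhenomena.PercolationContinuityZ3.Theorems.Transplant

open MeasureTheory Literature.Probability.Percolation Literature.Probability.LatticeModels SimpleGraph
open Literature.Geometry.MetricEmbeddings (cayleyGraph heisMul genA genB heisInv heisMul_assoc heisMul_zero_right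
  heisMul_zero_left heisMul_heisInv heisInv_heisMul heisInv_heisInv heisMul_right_injective heisMul_heisInv_cancel_left)
open Literature.Barriers.CriticalPhenomena (IsGraphTransitive)

namespace HeisGRR

/-! ## §1 The generating set `S₀ = {a, b, ab, ba²}^{±1}` and the Cayley graph `X` -/

/-- `S₀ = {a, a⁻¹, b, b⁻¹, ab, (ab)⁻¹, ba², (ba²)⁻¹}` in Heisenberg coordinates. [this work] -/
def S₀ : Finset (ℤ × ℤ × ℤ) :=
  {(1, 0, 0), (-1, 0, 0), (0, 1, 0), (0, -1, 0), (1, 1, 1), (-1, -1, 0), (2, 1, 0), (-2, -1, 2)}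

/-- `ab = (1,1,1)`, `ba² = (2,1,0)`: the last two generators are the words `ab` and `baa`. [folklore] -/
theorem words : heisMul (1, 0, 0) (0, 1, 0) = ((1, 1, 1) : ℤ × ℤ × ℤ) ∧
    heisMul (heisMul (0, 1, 0) (1, 0, 0)) (1, 0, 0) = ((2, 1, 0) : ℤ × ℤ × ℤ) := by decide

/-- `S₀` is symmetric. [folklore] -/
theorem S₀_symm : ∀ s ∈ S₀, heisInv s ∈ S₀ := by decide

/-- `1 ∉ S₀`. [folklore] -/
theorem zero_not_mem : ((0, 0, 0) : ℤ × ℤ × ℤ) ∉ S₀ := by decide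

/-- Elements of `S₀` are not the identity. [folklore] -/
theorem ne_zero_of_mem {s : ℤ × ℤ × ℤ} (hs : s ∈ S₀) : s ≠ (0, 0, 0) := fun h => zero_not_mem (h ▸ hs)

/-- `a ∈ S₀`. [folklore] -/
theorem genA_mem : genA ∈ S₀ := by show ((1 : ℤ), (0 : ℤ), (0 : ℤ)) ∈ S₀; decide

/-- `b ∈ S₀`. [folklore] -/
theorem genB_mem : genB ∈ S₀ := by show ((0 : ℤ), (1 : ℤ), (0 : ℤ)) ∈ S₀; decide

/-- The eight elements of `S₀`. [folklore] -/
theorem mem_S₀_cases : ∀ v ∈ S₀, v = (1, 0, 0) ∨ v = (-1, 0, 0) ∨ v = (0, 1, 0) ∨ v = (0, -1, 0) ∨ v = (1, 1, 1) ∨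
    v = (-1, -1, 0) ∨ v = (2, 1, 0) ∨ v = (-2, -1, 2) := by decide

/-- **`X = Cay(H₃(ℤ); S₀)`**, the right Cayley graph `g ∼ g·s`, `s ∈ S₀`. [this work] -/
abbrev X : SimpleGraph (ℤ × ℤ × ℤ) := HeisGens.graph S₀

/-- Adjacency in `X`: `h = g·s` for some `s ∈ S₀` (then `h ≠ g` automatically). [folklore] -/
theorem adj_iff (g h : ℤ × ℤ × ℤ) : X.Adj g h ↔ ∃ s ∈ S₀, h = heisMul g s := by
  rw [HeisGens.graph_adj_iff S₀_symm]
  refine ⟨fun h => h.2, fun ⟨s, hs, e⟩ => ⟨?_, s, hs, e⟩⟩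
  rw [e]; exact HeisGens.heisMul_ne_self (ne_zero_of_mem hs)

/-- The neighbours of the identity are exactly `S₀`. [folklore] -/
theorem adj_zero_iff (v : ℤ × ℤ × ℤ) : X.Adj (0, 0, 0) v ↔ v ∈ S₀ := by
  rw [adj_iff]
  refine ⟨?_, fun hv => ⟨v, hv, (heisMul_zero_left v).symm⟩⟩
  rintro ⟨s, hs, rfl⟩; rwa [heisMul_zero_left]

/-- `X` is connected (`a, b ∈ S₀`). [folklore] -/
theorem connected : X.Connected := HeisGens.graph_connected genA_mem genB_mem

/-- `X` is vertex-transitive. [folklore] -/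
theorem transitive : IsGraphTransitive X := HeisGens.graph_transitive

/-- `p_c(X) < 1` (`X ⊇ Cay(H₃(ℤ); a, b)`, whose `p_c` is `< 1`). [cite: BenjaminiSchramm1996, Thm. 1] -/
theorem criticalProb_lt_one : criticalProb X ((0, 0, 0) : ℤ × ℤ × ℤ) < 1 :=
  (criticalProb_anti_graph (HeisGens.cayleyGraph_le genA_mem genB_mem) _).trans_lt criticalProb_heisenberg_lt_one

/-! ## §2 The rooted link at radius 2: two decidable relations on `S₀` -/

/-- "common neighbour other than the identity": the 4-cycles through `1`. [this work] -/
def C (u w : ℤ × ℤ × ℤ) : Prop := ∃ x : ℤ × ℤ × ℤ, x ≠ (0, 0, 0) ∧ X.Adj u x ∧ X.Adj w x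

/-- `C` is symmetric. [folklore] -/
theorem C.symm {u w : ℤ × ℤ × ℤ} (h : C u w) : C w u := by
  obtain ⟨x, hx, h1, h2⟩ := h; exact ⟨x, hx, h2, h1⟩

/-- Raw (decidable) form of adjacency from a fixed vertex. [folklore] -/
def adjS (v w : ℤ × ℤ × ℤ) : Prop := ∃ s ∈ S₀, w = heisMul v s

/-- Raw (decidable) form of `C`. [folklore] -/
def Craw (u w : ℤ × ℤ × ℤ) : Prop := ∃ s ∈ S₀, heisMul u s ≠ (0, 0, 0) ∧ ∃ s' ∈ S₀, heisMul u s = heisMul w s'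

/-- `adjS` is decidable (a search over `S₀`). [folklore] -/
instance (v w : ℤ × ℤ × ℤ) : Decidable (adjS v w) := inferInstanceAs (Decidable (∃ s ∈ S₀, w = heisMul v s))

/-- `Craw` is decidable (a search over `S₀ × S₀`). [folklore] -/
instance (u w : ℤ × ℤ × ℤ) : Decidable (Craw u w) :=
  inferInstanceAs (Decidable (∃ s ∈ S₀, heisMul u s ≠ (0, 0, 0) ∧ ∃ s' ∈ S₀, heisMul u s = heisMul w s'))

/-- `X.Adj = adjS`. [folklore] -/
theorem adj_iff_adjS (v w : ℤ × ℤ × ℤ) : X.Adj v w ↔ adjS v w := adj_iff v w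

/-- `C = Craw`. [folklore] -/
theorem C_iff_Craw (u w : ℤ × ℤ × ℤ) : C u w ↔ Craw u w := by
  constructor
  · rintro ⟨x, hx0, hux, hwx⟩
    obtain ⟨s, hs, rfl⟩ := (adj_iff _ _).1 hux
    obtain ⟨s', hs', h'⟩ := (adj_iff _ _).1 hwx
    exact ⟨s, hs, hx0, s', hs', h'⟩
  · rintro ⟨s, hs, h0, s', hs', he⟩
    exact ⟨heisMul u s, h0, (adj_iff _ _).2 ⟨s, hs, rfl⟩, (adj_iff _ _).2 ⟨s', hs', he⟩⟩

/-- The edge-isolated points of the link are `ba²` and `(ba²)⁻¹` (the two generators in no triangle). [this work] -/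
theorem isolated_iff : ∀ v ∈ S₀, (∀ w ∈ S₀, ¬ adjS v w) ↔ (v = (2, 1, 0) ∨ v = (-2, -1, 2)) := by decide

/-- Link edges at `b`: only `a⁻¹`. [this work] -/
theorem T_b : ∀ w ∈ S₀, adjS (0, 1, 0) w → w = (-1, 0, 0) := by decide
/-- Link edges at `a⁻¹`: only `b`. [this work] -/
theorem T_ai : ∀ w ∈ S₀, adjS (-1, 0, 0) w → w = (0, 1, 0) := by decide
/-- Link edges at `a`: only `ab`. [this work] -/
theorem T_a : ∀ w ∈ S₀, adjS (1, 0, 0) w → w = (1, 1, 1) := by decide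
/-- Link edges at `b⁻¹`: only `(ab)⁻¹`. [this work] -/
theorem T_bi : ∀ w ∈ S₀, adjS (0, -1, 0) w → w = (-1, -1, 0) := by decide
/-- `b ∼ a⁻¹`. [this work] -/
theorem T_b_ai : adjS (0, 1, 0) (-1, 0, 0) := by decide
/-- `a ∼ ab`. [this work] -/
theorem T_a_ab : adjS (1, 0, 0) (1, 1, 1) := by decide
/-- `b⁻¹ ∼ (ab)⁻¹`. [this work] -/
theorem T_bi_abi : adjS (0, -1, 0) (-1, -1, 0) := by decide

/-- 4-cycles at `(ba²)⁻¹`: only with `a⁻¹` (`Craw` is reflexive on `S₀`, whence the first disjunct). [this work] -/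
theorem C_wi : ∀ w ∈ S₀, Craw (-2, -1, 2) w → w = (-2, -1, 2) ∨ w = (-1, 0, 0) := by decide
/-- 4-cycles at `ba²`: only with `b`. [this work] -/
theorem C_w : ∀ w ∈ S₀, Craw (2, 1, 0) w → w = (2, 1, 0) ∨ w = (0, 1, 0) := by decide
/-- 4-cycles at `b`: only with `ba²`. [this work] -/
theorem C_b : ∀ w ∈ S₀, Craw (0, 1, 0) w → w = (0, 1, 0) ∨ w = (2, 1, 0) := by decide
/-- 4-cycles at `a⁻¹`: with `(ba²)⁻¹` and with `a`. [this work] -/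
theorem C_ai : ∀ w ∈ S₀, Craw (-1, 0, 0) w → w = (-1, 0, 0) ∨ w = (-2, -1, 2) ∨ w = (1, 0, 0) := by decide
/-- 4-cycles at `a`: with `a⁻¹` and with `b⁻¹`. [this work] -/
theorem C_a : ∀ w ∈ S₀, Craw (1, 0, 0) w → w = (1, 0, 0) ∨ w = (-1, 0, 0) ∨ w = (0, -1, 0) := by decide
/-- the 4-cycle `1, b, ba, ba²`. [this work] -/
theorem C_w_b : Craw (2, 1, 0) (0, 1, 0) := by decide
/-- the 4-cycle `1, a⁻¹, a⁻¹b = (ba²)⁻¹ b⁻¹ …` through `a⁻²`. [this work] -/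
theorem C_ai_a : Craw (-1, 0, 0) (1, 0, 0) := by decide
/-- the 4-cycle `1, a, a², b⁻¹`. [this work] -/
theorem C_a_bi : Craw (1, 0, 0) (0, -1, 0) := by decide

/-! ## §3 An automorphism fixing the identity fixes its neighbours -/

section chase

variable (α : X ≃g X)

/-- Automorphisms fixing `1` preserve `S₀ = N(1)`. [folklore] -/
theorem mem_S₀_of_fix (h0 : α (0, 0, 0) = (0, 0, 0)) {v : ℤ × ℤ × ℤ} (hv : v ∈ S₀) : α v ∈ S₀ := by
  rw [← adj_zero_iff] at hv ⊢
  have := α.map_adj_iff.2 hv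
  rwa [h0] at this

/-- Automorphisms fixing `1` transport `C`. [folklore] -/
theorem C_map (h0 : α (0, 0, 0) = (0, 0, 0)) {u w : ℤ × ℤ × ℤ} (h : C u w) : C (α u) (α w) := by
  obtain ⟨x, hx0, hux, hwx⟩ := h
  refine ⟨α x, fun hx => hx0 ?_, α.map_adj_iff.2 hux, α.map_adj_iff.2 hwx⟩
  exact α.injective (hx.trans h0.symm)

/-- The inverse of an automorphism fixing `1` fixes `1`. [folklore] -/
theorem symm_fix (h0 : α (0, 0, 0) = (0, 0, 0)) : α.symm (0, 0, 0) = (0, 0, 0) := by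
  have h := RelIso.symm_apply_apply α (0, 0, 0)
  rwa [h0] at h

/-- **The chase**: an automorphism of `X` fixing the identity fixes each of its eight neighbours. [this work] -/
theorem aut_fix_neighbors_zero (h0 : α (0, 0, 0) = (0, 0, 0)) : ∀ v ∈ S₀, α v = v := by
  have hN : ∀ {v}, v ∈ S₀ → α v ∈ S₀ := fun hv => mem_S₀_of_fix α h0 hv
  have hN' : ∀ {v}, v ∈ S₀ → α.symm v ∈ S₀ := fun hv => mem_S₀_of_fix α.symm (symm_fix α h0) hv
  -- transport of the two link relations (in raw form)
  have hT : ∀ {u w}, adjS u w → adjS (α u) (α w) := fun h =>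
    (adj_iff_adjS _ _).1 (α.map_adj_iff.2 ((adj_iff_adjS _ _).2 h))
  have hC : ∀ {u w}, Craw u w → Craw (α u) (α w) := fun h =>
    (C_iff_Craw _ _).1 (C_map α h0 ((C_iff_Craw _ _).2 h))
  -- isolated points go to isolated points
  have hiso : ∀ {v}, v ∈ S₀ → (∀ w ∈ S₀, ¬ adjS v w) → ∀ w ∈ S₀, ¬ adjS (α v) w := by
    intro v hv hv' w hw h
    have h' : adjS v (α.symm w) := by
      have := (adj_iff_adjS _ _).1 (α.symm.map_adj_iff.2 ((adj_iff_adjS _ _).2 h))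
      rwa [RelIso.symm_apply_apply] at this
    exact hv' _ (hN' hw) h'
  have hWmem : ((2, 1, 0) : ℤ × ℤ × ℤ) ∈ S₀ := by decide
  have hWimem : ((-2, -1, 2) : ℤ × ℤ × ℤ) ∈ S₀ := by decide
  have hBmem : ((0, 1, 0) : ℤ × ℤ × ℤ) ∈ S₀ := by decide
  have hAimem : ((-1, 0, 0) : ℤ × ℤ × ℤ) ∈ S₀ := by decide
  have hAmem : ((1, 0, 0) : ℤ × ℤ × ℤ) ∈ S₀ := by decide
  have hBimem : ((0, -1, 0) : ℤ × ℤ × ℤ) ∈ S₀ := by decide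
  have hABmem : ((1, 1, 1) : ℤ × ℤ × ℤ) ∈ S₀ := by decide
  have hABimem : ((-1, -1, 0) : ℤ × ℤ × ℤ) ∈ S₀ := by decide
  have hWiso : ∀ w ∈ S₀, ¬ adjS (2, 1, 0) w := (isolated_iff _ hWmem).2 (Or.inl rfl)
  have hWiiso : ∀ w ∈ S₀, ¬ adjS (-2, -1, 2) w := (isolated_iff _ hWimem).2 (Or.inr rfl)
  -- injectivity bookkeeping
  have hne : ∀ {u u' : ℤ × ℤ × ℤ}, α u = α u' → u = u' := fun h => α.injective h
  -- Step 1–2: `α (ba²) = ba²`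
  have hW : α (2, 1, 0) = (2, 1, 0) := by
    rcases (isolated_iff _ (hN hWmem)).1 (hiso hWmem hWiso) with h | h
    · exact h
    · exfalso
      -- `b` is the 4-cycle partner of `ba²`, so `α b` is a partner of `(ba²)⁻¹`, i.e. `a⁻¹`
      have h1' : Craw (-2, -1, 2) (α (0, 1, 0)) := by have := hC C_w_b; rwa [h] at this
      have h1 : α (0, 1, 0) = (-1, 0, 0) := by
        rcases C_wi _ (hN hBmem) h1' with h1 | h1
        · exact absurd (hne (h1.trans h.symm)) (by decide)
        · exact h1
      -- `a⁻¹` is the link-edge partner of `b`, so `α a⁻¹` is the partner of `a⁻¹`, i.e. `b`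
      have h2' : adjS (-1, 0, 0) (α (-1, 0, 0)) := by have := hT T_b_ai; rwa [h1] at this
      have h2 : α (-1, 0, 0) = (0, 1, 0) := T_ai _ (hN hAimem) h2'
      -- `a` is a 4-cycle partner of `a⁻¹`, so `α a` is a partner of `b`, i.e. `ba²` — but `a` has a link edge and `ba²` has none
      have h3' : Craw (0, 1, 0) (α (1, 0, 0)) := by have := hC C_ai_a; rwa [h2] at this
      have h3 : α (1, 0, 0) = (2, 1, 0) := by
        rcases C_b _ (hN hAmem) h3' with h3 | h3
        · exact absurd (hne (h3.trans h2.symm)) (by decide)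
        · exact h3
      have h4 : adjS (2, 1, 0) (α (1, 1, 1)) := by have := hT T_a_ab; rwa [h3] at this
      exact hWiso _ (hN hABmem) h4
  -- Step 3: `α (ba²)⁻¹ = (ba²)⁻¹`
  have hWi : α (-2, -1, 2) = (-2, -1, 2) := by
    rcases (isolated_iff _ (hN hWimem)).1 (hiso hWimem hWiiso) with h | h
    · exact absurd (hne (h.trans hW.symm)) (by decide)
    · exact h
  -- Steps 4–9
  have hB : α (0, 1, 0) = (0, 1, 0) := by
    have h' : Craw (2, 1, 0) (α (0, 1, 0)) := by have := hC C_w_b; rwa [hW] at this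
    rcases C_w _ (hN hBmem) h' with h | h
    · exact absurd (hne (h.trans hW.symm)) (by decide)
    · exact h
  have hAi : α (-1, 0, 0) = (-1, 0, 0) := by
    have h' : adjS (0, 1, 0) (α (-1, 0, 0)) := by have := hT T_b_ai; rwa [hB] at this
    exact T_b _ (hN hAimem) h'
  have hA : α (1, 0, 0) = (1, 0, 0) := by
    have h' : Craw (-1, 0, 0) (α (1, 0, 0)) := by have := hC C_ai_a; rwa [hAi] at this
    rcases C_ai _ (hN hAmem) h' with h | h | h
    · exact absurd (hne (h.trans hAi.symm)) (by decide)
    · exact absurd (hne (h.trans hWi.symm)) (by decide)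
    · exact h
  have hAB : α (1, 1, 1) = (1, 1, 1) := by
    have h' : adjS (1, 0, 0) (α (1, 1, 1)) := by have := hT T_a_ab; rwa [hA] at this
    exact T_a _ (hN hABmem) h'
  have hBi : α (0, -1, 0) = (0, -1, 0) := by
    have h' : Craw (1, 0, 0) (α (0, -1, 0)) := by have := hC C_a_bi; rwa [hA] at this
    rcases C_a _ (hN hBimem) h' with h | h | h
    · exact absurd (hne (h.trans hA.symm)) (by decide)
    · exact absurd (hne (h.trans hAi.symm)) (by decide)
    · exact h
  have hABi : α (-1, -1, 0) = (-1, -1, 0) := by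
    have h' : adjS (0, -1, 0) (α (-1, -1, 0)) := by have := hT T_bi_abi; rwa [hBi] at this
    exact T_bi _ (hN hABimem) h'
  intro v hv
  rcases mem_S₀_cases v hv with rfl | rfl | rfl | rfl | rfl | rfl | rfl | rfl <;> assumption

end chase

/-! ## §4 Consequences: `X` is a GRR -/

/-- **An automorphism fixing a vertex fixes all its neighbours** (conjugate the chase by a left translation). [this work] -/
theorem aut_fix_neighbors (α : X ≃g X) {v : ℤ × ℤ × ℤ} (hv : α v = v) {u : ℤ × ℤ × ℤ} (hu : X.Adj v u) : α u = u := by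
  let β : X ≃g X := (HeisGens.leftIso v).trans (α.trans (HeisGens.leftIso (heisInv v)))
  have hβ : ∀ w, β w = heisMul (heisInv v) (α (heisMul v w)) := fun w => rfl
  have hβ0 : β (0, 0, 0) = (0, 0, 0) := by rw [hβ, heisMul_zero_right, hv, heisInv_heisMul]
  obtain ⟨s, hs, rfl⟩ := (adj_iff _ _).1 hu
  have hβs : β s = s := aut_fix_neighbors_zero β hβ0 s hs
  rw [hβ] at hβs
  have := congrArg (heisMul v) hβs
  rwa [heisMul_heisInv_cancel_left] at this

/-- **An automorphism of `X` with a fixed point is the identity** (`X` is connected). [this work] -/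
theorem aut_eq_of_fix (α : X ≃g X) {v : ℤ × ℤ × ℤ} (hv : α v = v) (w : ℤ × ℤ × ℤ) : α w = w := by
  obtain ⟨p⟩ := connected.preconnected v w
  induction p with
  | nil => exact hv
  | cons h _ ih => exact ih (aut_fix_neighbors α hv h)

/-- **`X` is a graphical regular representation of `H₃(ℤ)`**: every automorphism is a left translation (existence of SOME finite-degree
GRR of `H₃(ℤ)` is Leemann–de la Salle's theorem; this is an explicit one). [cite: LeemannDelasalle2022, Cor. 1.2] -/
theorem aut_eq_leftIso (α : X ≃g X) (w : ℤ × ℤ × ℤ) : α w = heisMul (α (0, 0, 0)) w := by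
  let β : X ≃g X := α.trans (HeisGens.leftIso (heisInv (α (0, 0, 0))))
  have hβ : ∀ u, β u = heisMul (heisInv (α (0, 0, 0))) (α u) := fun u => rfl
  have hβ0 : β (0, 0, 0) = (0, 0, 0) := by rw [hβ, heisInv_heisMul]
  have h := aut_eq_of_fix β hβ0 w
  rw [hβ] at h
  have := congrArg (heisMul (α (0, 0, 0))) h
  rwa [heisMul_heisInv_cancel_left] at this

/-- The vertex stabilisers of `X` are trivial. [this work] -/
theorem stabilizer_trivial (α : X ≃g X) {v : ℤ × ℤ × ℤ} (hv : α v = v) : α = RelIso.refl X.Adj :=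
  RelIso.ext (aut_eq_of_fix α hv)

/-! ## §5 No planar skeleton with a point symmetry on `X`, for any skeleton map -/

/-- **No "point symmetry" acts non-trivially on neighbour displacements**: if an automorphism fixing `t` acts on `φ − φ t` through ANY
map `L`, then `L` fixes the displacement of every neighbour of `t`. [this work] -/
theorem no_point_symmetry {W : Type} (φ : ℤ × ℤ × ℤ → W) [AddGroup W] (L : W → W) (t : ℤ × ℤ × ℤ) (α : X ≃g X)
    (hαt : α t = t) (hα : ∀ w, φ (α w) - φ t = L (φ w - φ t)) {u : ℤ × ℤ × ℤ} (hu : X.Adj t u) :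
    L (φ u - φ t) = φ u - φ t := by
  rw [← hα u, aut_fix_neighbors α hαt hu]

/-- **THEOREM (row 34): `X` carries no `PlanarSkeletonNeg`** — for any skeleton map: the central inversion at a base vertex would fix
the outward `e₀`-step neighbour, forcing `e₀ = −e₀`. [cite: KozmaNitzan2024, §4 p. 16 (Lemma 8)] [cite: BenjaminiSchramm1996, Conj. 4] -/
theorem isEmpty_planarSkeletonNeg : IsEmpty (PlanarSkeletonNeg X) := by
  refine ⟨fun Φ => ?_⟩
  obtain ⟨t, ht, -⟩ := Φ.frame (0, 0, 0)
  obtain ⟨α, hαt, hα⟩ := Φ.neg t ht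
  obtain ⟨t', hadj, hφ⟩ := Φ.step t 0 1
  have h := no_point_symmetry Φ.φ (fun y => -y) t α hαt hα hadj
  have e : Φ.φ t' - Φ.φ t = Pi.single 0 ((1 : ℤˣ) : ℤ) := by rw [hφ, add_sub_cancel_left]
  rw [e] at h
  have := congrFun h 0
  simp at this

/-- **`X` carries no `PlanarSkeletonSign`.** [cite: KozmaNitzan2024, §4 p. 16 (Lemma 8)] -/
theorem isEmpty_planarSkeletonSign : IsEmpty (PlanarSkeletonSign X) :=
  ⟨fun Φ => isEmpty_planarSkeletonNeg.false Φ.toPlanarSkeletonNeg⟩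

/-- **`X` carries no `PlanarSkeletonConc`** (the node of record cannot be instantiated on this Cayley graph of `H₃(ℤ)`).
[cite: KozmaNitzan2024, §4 p. 16 (Lemma 8)] -/
theorem isEmpty_planarSkeletonConc : IsEmpty (PlanarSkeletonConc X) :=
  ⟨fun Φ => isEmpty_planarSkeletonNeg.false Φ.toNeg⟩

end HeisGRR

end Summit.CriticalPhenomena.PercolationContinuityZ3.Theorems.Transplant

end
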